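import Summits.RiemannHypothesis.RiemannHypothesis.Theorems.JensenLogBandFarZoneCompetitorXi
import HarnessLib

/-!
# The radial bridge, pointwise ([S5b-pt], regime R2): the vertical-segment integrand against the peak

RH ladder column JENSEN, rung J-P(P3) «log band», BAND crux `XiDerivBandRealAllRates`
(stmt-RiemannHypothesis-19913) of route «JensenLogBand», line «band-one-window» (top-shell reshape,
BAND lead rh-jensen-prover g8) — pointwise input for the lead's radial bridge [S5b]: the sector
identity `rightArc_sub_rightArc_eq` moves the own half-arc from radius `h` to the saddle radius
`r* = ‖u* − c‖` at the price of `I·∫_{h₂}^{h₁}(g(c+ir) + g(c−ir))dr`, `g(u) = ξ(½+u)·K_{n,c}(u)`,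
over `[h₂, h₁] = [min(h,r*), max(h,r*)]` (length `≤ ε = (2+16h/5)/ℓ_T` by F4). RH-FREE.
WHAT THIS IS NOT: nothing here bears on zeros of `ζ` or the truth of RH.

* `norm_sqKernel_vertical_le` — kernel on the vertical segment vs the saddle kernel:
  `‖K_{n,c}(c ± iy)‖ ≤ e^{6h+12} ‖K_{n,c}(u*)‖` for `|y − h| ≤ ε`, `|y − r*| ≤ ε`;
* **`norm_vertical_integrand_le`**: for such `y` and `0 < δ ≤ 1` with `1 + δ ≤ σ* = Re(½+u*)`:
  `‖ξ(½ + (c ± iy))‖·‖K_{n,c}(c ± iy)‖ ≤ 672·log(T+y)·e^{8h+12}·exp(−(σ*−1−δ)(ℓ_T/2 − 1))·‖I_{r*}(φ₀)‖/r*`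
  (the points `½ + x + i(T ± y)` have abscissa `½ + x ∈ [0,1]`: flat majorant F2 + vertical γ̃ +
  F7c). Hence the bridge is `O(ε)·ℓ·e^{−(σ*−1−δ)ℓ/2}·‖I(φ₀)‖`, negligible against the window.

Regime: `|x| ≤ ½`, `T ≥ 100`, `ℓ_T ≥ 20`, `n ≥ 100`, `½ ≤ h ≤ (7/20)T`, `h ≤ 20`, `u*` in the S3 disc
with `S_{n,c}(u*) = 0`. (prover-rh-jensen-eng-2-g6-0, 2026-08-27.)
-/

noncomputable section

-- single-problem summit: `Summit.RiemannHypothesis.RiemannHypothesis.…` is the tree convention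
set_option linter.dupNamespace false

open Complex Real Set

namespace Summit.RiemannHypothesis.RiemannHypothesis.Theorems.JensenPolynomials.LogBandArc

open Literature.NumberTheory.LFunctions

variable {n : ℕ} {x T : ℝ} {u : ℂ}

set_option maxHeartbeats 400000 in -- long chain of explicit norm estimates in a large context, no search
/-- **Kernel on the vertical segment vs the saddle kernel (R2):** for `y` with `|y − h| ≤ ε` and
`|y − r*| ≤ ε` (`ε = (2 + 16h/5)/ℓ_T`), and either sign `σ = ±1`:
`‖K_{n,c}(c + σ·iy)‖ ≤ e^{6h+12} ‖K_{n,c}(u*)‖`. [folklore] -/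
theorem norm_sqKernel_vertical_le (hx : |x| ≤ 1 / 2) (hT : 100 ≤ T)
    (hℓ : 20 ≤ ell T) (hn : 100 ≤ n) (hh : 1 / 2 ≤ bandRadius n T)
    (hhT : bandRadius n T ≤ 7 / 20 * T) (hH : bandRadius n T ≤ 20)
    (hu : ‖u - ((x : ℂ) + (T : ℂ) * I + bandRadius n T)‖ ≤ 3 / 5 * bandRadius n T)
    (hS : arcSaddleFn n ((x : ℂ) + (T : ℂ) * I) u = 0) {y sgn : ℝ} (hsgn : sgn = 1 ∨ sgn = -1)
    (hyh : |y - bandRadius n T| ≤ (2 + 16 / 5 * bandRadius n T) / ell T)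
    (hyr : |y - ‖u - ((x : ℂ) + (T : ℂ) * I)‖| ≤ (2 + 16 / 5 * bandRadius n T) / ell T) :
    ‖sqKernel n ((x : ℂ) + (T : ℂ) * I) (((x : ℂ) + (T : ℂ) * I) + ((sgn * y : ℝ) : ℂ) * I)‖ ≤
      Real.exp (6 * bandRadius n T + 12) * ‖sqKernel n ((x : ℂ) + (T : ℂ) * I) u‖ := by
  obtain ⟨-, hεh, hε33, hT1200, hnT⟩ := R2_bookkeeping hT hℓ hh hH
  obtain ⟨hre_lo, him_abs, hr_lo, hr_hi⟩ := arcSaddle_sharp_polar hx hT hℓ hn hh hhT hH hu hS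
  have hℓ0 : 0 < ell T := by linarith
  have hεℓ : (2 + 16 / 5 * bandRadius n T) / ell T * ell T = 2 + 16 / 5 * bandRadius n T :=
    div_mul_cancel₀ _ hℓ0.ne'
  have hhℓ : bandRadius n T * ell T = 2 * ((n : ℝ) + 1) := bandRadius_mul_ell hℓ
  have hcim : ((x : ℂ) + (T : ℂ) * I).im = T := by simp
  have hcre : ((x : ℂ) + (T : ℂ) * I).re = x := by simp
  generalize hε' : (2 + 16 / 5 * bandRadius n T) / ell T = ε at *
  generalize hh' : bandRadius n T = h at *
  generalize hℓ' : ell T = ℓ at *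
  generalize hc : ((x : ℂ) + (T : ℂ) * I) = c at *
  generalize hr' : ‖u - c‖ = r at *
  have hx1 := abs_le.1 hx
  have hsg1 : |sgn| = 1 := by rcases hsgn with h1 | h1 <;> simp [h1]
  have hh0 : 0 < h := by linarith only [hh]
  have hrlo : 16 / 25 * h ≤ r := by linarith only [hr_lo, hεh]
  have hr0 : 0 < r := by linarith only [hrlo, hh0]
  have hyr' := abs_le.1 hyr
  have hyh' := abs_le.1 hyh
  have hylo : 16 / 25 * h ≤ y := by linarith only [hyh'.1, hεh]
  have hy0 : 0 < y := by linarith only [hylo, hh0]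
  have hyhi : y ≤ 28 := by linarith only [hyh'.2, hεh, hH]
  have hrhi : r ≤ 28 := by linarith only [hr_hi, hεh, hH]
  have him_u := abs_le.1 him_abs
  -- the point `p = c + sgn·y·i`: `p − c = sgn y i`, `‖p − c‖ = y`, `p + c = 2c + sgn y i`
  set p : ℂ := c + ((sgn * y : ℝ) : ℂ) * I with hp
  have hpc : ‖p - c‖ = y := by
    rw [hp, show c + ((sgn * y : ℝ) : ℂ) * I - c = ((sgn * y : ℝ) : ℂ) * I by ring, norm_mul,
      Complex.norm_I, mul_one, Complex.norm_real, Real.norm_eq_abs, abs_mul, hsg1, one_mul, abs_of_pos hy0]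
  have hp_norm : ‖p‖ ≤ T + 29 := by
    have hcn : ‖c‖ ≤ 1 / 2 + T := by
      rw [← hc]
      calc ‖(x : ℂ) + (T : ℂ) * I‖ ≤ ‖(x : ℂ)‖ + ‖(T : ℂ) * I‖ := norm_add_le _ _
        _ ≤ 1 / 2 + T := by
            rw [norm_mul, Complex.norm_I, mul_one, Complex.norm_real, Complex.norm_real,
              Real.norm_eq_abs, Real.norm_eq_abs, abs_of_nonneg (show (0 : ℝ) ≤ T by linarith only [hT1200])]
            linarith only [hx]
    have := norm_add_le c (p - c)
    rw [show c + (p - c) = p by ring, hpc] at this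
    linarith only [this, hcn, hyhi]
  have hpc2 : 2 * T - 28 ≤ ‖p + c‖ := by
    have e : (p + c).im = 2 * T + sgn * y := by
      rw [hp]; simp [hcim]; ring
    have h1 : 2 * T - 28 ≤ (p + c).im := by
      rw [e]
      have : -y ≤ sgn * y := by
        rcases hsgn with h1 | h1 <;> rw [h1] <;> linarith only [hy0]
      linarith only [this, hyhi]
    have := Complex.abs_im_le_norm (p + c)
    rw [abs_of_pos (by linarith only [h1, hT1200])] at this
    linarith only [this, h1]
  -- the saddle point: `‖u‖ ≥ T − 4`, `‖u + c‖ ≤ 2T + 30`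
  have hu_norm : T - 33 / 10 ≤ ‖u‖ := by
    have e : u.im = (u - c).im + T := by rw [Complex.sub_im, hcim]; ring
    have := Complex.abs_im_le_norm u
    rw [abs_of_pos (by rw [e]; linarith only [him_u.1, hε33, hT1200])] at this
    rw [e] at this; linarith only [this, him_u.1, hε33]
  have huc_hi : ‖u + c‖ ≤ 2 * T + 30 := by
    have hcn : ‖c‖ ≤ 1 / 2 + T := by
      rw [← hc]
      calc ‖(x : ℂ) + (T : ℂ) * I‖ ≤ ‖(x : ℂ)‖ + ‖(T : ℂ) * I‖ := norm_add_le _ _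
        _ ≤ 1 / 2 + T := by
            rw [norm_mul, Complex.norm_I, mul_one, Complex.norm_real, Complex.norm_real,
              Real.norm_eq_abs, Real.norm_eq_abs, abs_of_nonneg (show (0 : ℝ) ≤ T by linarith only [hT1200])]
            linarith only [hx]
    have h1 := norm_add_le (u - c) (c + c)
    rw [show (u - c) + (c + c) = u + c by ring, hr'] at h1
    have h2 := norm_add_le c c
    linarith only [h1, h2, hcn, hrhi]
  have huc0 : 0 < ‖u + c‖ := by
    have e : (u + c).im = (u - c).im + 2 * T := by rw [Complex.add_im, Complex.sub_im, hcim]; ring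
    have h1 : 0 < (u + c).im := by rw [e]; linarith only [him_u.1, hε33, hT1200]
    exact lt_of_lt_of_le h1 ((le_abs_self _).trans (Complex.abs_im_le_norm _))
  -- power ratio: `(r‖u+c‖)^{n+1} ≤ e^{s(n+1)} (y‖p+c‖)^{n+1}` with `r ≤ (1 + ε/(y... ))y`
  -- `r ≤ y + ε ≤ (1 + 25ε/(7h)) y`  and  `‖u+c‖ ≤ (1 + 58/(2T−28)) ‖p+c‖`
  obtain ⟨sx, hsx⟩ : ∃ s : ℝ, s = 25 * ε / (7 * h) + 58 / (2 * T - 28) +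
      25 * ε / (7 * h) * (58 / (2 * T - 28)) := ⟨_, rfl⟩
  have hε0 : 0 ≤ ε := (abs_nonneg _).trans hyr
  have ha0 : 0 ≤ 25 * ε / (7 * h) := by positivity
  have hb0 : 0 ≤ 58 / (2 * T - 28) := div_nonneg (by norm_num) (by linarith only [hT1200])
  have hsx0 : 0 ≤ sx := by rw [hsx]; positivity
  have hbase : r * ‖u + c‖ ≤ (1 + sx) * (y * ‖p + c‖) := by
    have h1 : r ≤ (1 + 25 * ε / (7 * h)) * y := by
      rw [add_mul, one_mul]
      have : ε ≤ 25 * ε / (7 * h) * y := by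
        rw [div_mul_eq_mul_div, le_div_iff₀ (by positivity)]
        have hprod := mul_le_mul_of_nonneg_left hylo hε0
        nlinarith only [hprod, hε0, hh0]
      linarith only [hyr'.1, this]
    have h2 : ‖u + c‖ ≤ (1 + 58 / (2 * T - 28)) * ‖p + c‖ := by
      have h3 : ‖u + c‖ ≤ ‖p + c‖ + 58 := by linarith only [huc_hi, hpc2]
      have h4 : (58 : ℝ) ≤ 58 / (2 * T - 28) * ‖p + c‖ := by
        rw [div_mul_eq_mul_div, le_div_iff₀ (by linarith only [hT1200])]
        nlinarith only [hpc2]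
      linarith only [h3, h4]
    calc r * ‖u + c‖ ≤ ((1 + 25 * ε / (7 * h)) * y) * ((1 + 58 / (2 * T - 28)) * ‖p + c‖) :=
          mul_le_mul h1 h2 (norm_nonneg _) (by positivity)
      _ = (1 + sx) * (y * ‖p + c‖) := by rw [hsx]; ring
  have hpow : (r * ‖u + c‖) ^ (n + 1) ≤ Real.exp (6 * h + 12) / Real.exp (3 / 100) * (y * ‖p + c‖) ^ (n + 1) := by
    have h1' : (r * ‖u + c‖) ^ (n + 1) ≤ ((1 + sx) * (y * ‖p + c‖)) ^ (n + 1) :=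
      pow_le_pow_left₀ (by positivity) hbase (n + 1)
    have h1 : (r * ‖u + c‖) ^ (n + 1) ≤ (1 + sx) ^ (n + 1) * (y * ‖p + c‖) ^ (n + 1) := by
      rw [← mul_pow]; exact h1'
    have h2 : (1 + sx) ^ (n + 1) ≤ Real.exp (((n + 1 : ℕ) : ℝ) * sx) := by
      calc (1 + sx) ^ (n + 1) ≤ (Real.exp sx) ^ (n + 1) := by
            apply pow_le_pow_left₀ (by positivity)
            have := Real.add_one_le_exp sx; linarith only [this]
        _ = Real.exp (((n + 1 : ℕ) : ℝ) * sx) := by rw [← Real.exp_nat_mul]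
    have h3 : ((n + 1 : ℕ) : ℝ) * sx ≤ 6 * h + 12 - 3 / 100 := by
      push_cast
      have hn1 : ((n : ℝ) + 1) = h * ℓ / 2 := by linarith only [hhℓ]
      -- `(n+1)·25ε/(7h) = (25/14) εℓ = (25/14)(2 + 16h/5)`
      have e1 : ((n : ℝ) + 1) * (25 * ε / (7 * h)) = 25 / 14 * (2 + 16 / 5 * h) := by
        calc ((n : ℝ) + 1) * (25 * ε / (7 * h)) = (h * ℓ / 2) * (25 * ε / (7 * h)) := by rw [hn1]
          _ = 25 / 14 * (ε * ℓ) * (h / h) := by ring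
          _ = 25 / 14 * (ε * ℓ) := by rw [div_self hh0.ne', mul_one]
          _ = 25 / 14 * (2 + 16 / 5 * h) := by rw [hεℓ]
      have e2 : ((n : ℝ) + 1) * (58 / (2 * T - 28)) ≤ 5 := by
        rw [mul_div_assoc', div_le_iff₀ (by linarith only [hT1200])]
        linarith only [hnT, hT1200]
      have e3 : ((n : ℝ) + 1) * (25 * ε / (7 * h) * (58 / (2 * T - 28))) ≤ 3 := by
        rw [← mul_assoc, e1]
        have hb : 58 / (2 * T - 28) ≤ 1 / 40 := by
          rw [div_le_iff₀ (by linarith only [hT1200])]; linarith only [hT1200]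
        have ha : 25 / 14 * (2 + 16 / 5 * h) ≤ 25 / 14 * 66 := by linarith only [hH]
        calc 25 / 14 * (2 + 16 / 5 * h) * (58 / (2 * T - 28)) ≤ (25 / 14 * 66) * (1 / 40) :=
              mul_le_mul ha hb hb0 (by norm_num)
          _ ≤ 3 := by norm_num
      rw [hsx, mul_add, mul_add, e1]
      linarith only [e2, e3, hh0]
    have h4 := h2.trans (Real.exp_le_exp.2 h3)
    have h5 : Real.exp (6 * h + 12 - 3 / 100) = Real.exp (6 * h + 12) / Real.exp (3 / 100) := by
      rw [Real.exp_sub]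
    rw [← h5]
    exact h1.trans (mul_le_mul_of_nonneg_right h4 (by positivity))
  -- assemble
  rw [norm_sqKernel_eq, norm_sqKernel_eq, hpc, hr']
  have hA0 : 0 < (y * ‖p + c‖) ^ (n + 1) := by
    apply pow_pos; exact mul_pos hy0 (by linarith only [hpc2, hT1200])
  have hB0 : 0 < (r * ‖u + c‖) ^ (n + 1) := by positivity
  generalize hA : (y * ‖p + c‖) ^ (n + 1) = A at hA0 hpow ⊢
  generalize hB : (r * ‖u + c‖) ^ (n + 1) = B at hB0 hpow ⊢
  have hu0 : 0 < ‖u‖ := by linarith only [hu_norm, hT1200]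
  -- `‖p‖ ≤ e^{3/100} ‖u‖`
  have hpu : ‖p‖ ≤ Real.exp (3 / 100) * ‖u‖ := by
    have h1 : ‖p‖ ≤ (1 + 3 / 100) * ‖u‖ := by nlinarith only [hp_norm, hu_norm, hT1200]
    have h2 : (1 + 3 / 100 : ℝ) ≤ Real.exp (3 / 100) := by
      have := Real.add_one_le_exp (3 / 100 : ℝ); linarith only [this]
    nlinarith only [h1, h2, hu0]
  have h1B : 1 / A ≤ (Real.exp (6 * h + 12) / Real.exp (3 / 100)) / B := by
    rw [div_le_div_iff₀ hA0 hB0, one_mul]; exact hpow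
  have he3 : 0 < Real.exp (3 / 100) := Real.exp_pos _
  calc 2 * ‖p‖ / A = 2 * ‖p‖ * (1 / A) := by ring
    _ ≤ 2 * (Real.exp (3 / 100) * ‖u‖) * ((Real.exp (6 * h + 12) / Real.exp (3 / 100)) / B) :=
        mul_le_mul (by linarith only [hpu]) h1B (by positivity) (by positivity)
    _ = Real.exp (6 * h + 12) * (2 * ‖u‖ / B) := by field_simp

/-- **[S5b-pt] — the vertical-segment integrand against the own peak (R2).** For `y` between `h`
and `r*` (precisely `|y − h| ≤ ε`, `|y − r*| ≤ ε`, `ε = (2+16h/5)/ℓ_T`), either sign, and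
`0 < δ ≤ 1` with `1 + δ ≤ σ* = Re(½ + u*)`:
`‖ξ(½ + (c ± iy))‖·‖K_{n,c}(c ± iy)‖ ≤ 672·log(T+y)·e^{8h+12}·exp(−(σ*−1−δ)(ℓ_T/2−1))·‖I_{r*}(φ₀)‖/r*`.
RH-FREE. [folklore] -/
theorem norm_vertical_integrand_le {δ : ℝ} (hx : |x| ≤ 1 / 2) (hT : 100 ≤ T)
    (hℓ : 20 ≤ ell T) (hn : 100 ≤ n) (hh : 1 / 2 ≤ bandRadius n T)
    (hhT : bandRadius n T ≤ 7 / 20 * T) (hH : bandRadius n T ≤ 20)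
    (hu : ‖u - ((x : ℂ) + (T : ℂ) * I + bandRadius n T)‖ ≤ 3 / 5 * bandRadius n T)
    (hS : arcSaddleFn n ((x : ℂ) + (T : ℂ) * I) u = 0) (hδ : 0 < δ) (hδ1 : δ ≤ 1)
    (hδσ : 1 + δ ≤ (1 / 2 + u).re) {y sgn : ℝ} (hsgn : sgn = 1 ∨ sgn = -1)
    (hyh : |y - bandRadius n T| ≤ (2 + 16 / 5 * bandRadius n T) / ell T)
    (hyr : |y - ‖u - ((x : ℂ) + (T : ℂ) * I)‖| ≤ (2 + 16 / 5 * bandRadius n T) / ell T) :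
    ‖xiSq ((((x : ℂ) + (T : ℂ) * I) + ((sgn * y : ℝ) : ℂ) * I) ^ 2)‖ *
        ‖sqKernel n ((x : ℂ) + (T : ℂ) * I) (((x : ℂ) + (T : ℂ) * I) + ((sgn * y : ℝ) : ℂ) * I)‖ ≤
      672 * Real.log (T + y) * Real.exp (8 * bandRadius n T + 12) *
        Real.exp (-(((1 / 2 + u).re - (1 + δ)) * (ell T / 2 - 1))) *
        (‖arcModelIntegrand n ‖u - ((x : ℂ) + (T : ℂ) * I)‖ ((x : ℂ) + (T : ℂ) * I)
          (Complex.arg (u - ((x : ℂ) + (T : ℂ) * I)))‖ / ‖u - ((x : ℂ) + (T : ℂ) * I)‖) := by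
  obtain ⟨-, hεh, hε33, hT1200, -⟩ := R2_bookkeeping hT hℓ hh hH
  obtain ⟨-, -, hr_lo, -⟩ := arcSaddle_sharp_polar hx hT hℓ hn hh hhT hH hu hS
  have hK := norm_sqKernel_vertical_le hx hT hℓ hn hh hhT hH hu hS hsgn hyh hyr
  have hγ := norm_xiGammaFactor_line_le_saddle (δ := δ) hx hT hℓ hn hh hhT hH hu hS (by linarith) hδσ
  have hx1 := abs_le.1 hx
  have hsg1 : |sgn| = 1 := by rcases hsgn with h1 | h1 <;> simp [h1]
  have hh0 : 0 < bandRadius n T := by linarith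
  have hr0 : 0 < ‖u - ((x : ℂ) + (T : ℂ) * I)‖ := by linarith
  have hyh' := abs_le.1 hyh
  have hy0 : 0 < y := by linarith
  have hyhi : y ≤ 28 := by linarith
  -- `ξ` at `½ + x + i(T + sgn y)`: abscissa `½ + x ∈ [0,1]`, height `≥ T − 28`
  set s : ℂ := 1 / 2 + (((x : ℂ) + (T : ℂ) * I) + ((sgn * y : ℝ) : ℂ) * I) with hs
  have hsq : (((x : ℂ) + (T : ℂ) * I) + ((sgn * y : ℝ) : ℂ) * I) ^ 2 =
      (((x : ℂ) + (T : ℂ) * I) + ((sgn * y : ℝ) : ℂ) * I) ^ 2 := rfl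
  have hsre : s.re = 1 / 2 + x := by rw [hs]; simp
  have hsim : s.im = T + sgn * y := by rw [hs]; simp
  have h0 : 0 ≤ s.re := by rw [hsre]; linarith only [hx1.1]
  have h1 : s.re ≤ 1 + δ := by rw [hsre]; linarith only [hx1.2, hδ]
  have hsy : -y ≤ sgn * y ∧ sgn * y ≤ y := by
    rcases hsgn with h1 | h1 <;> rw [h1] <;> constructor <;> linarith only [hy0]
  have him12 : 12 ≤ s.im := by rw [hsim]; linarith only [hsy.1, hyhi, hT1200]
  have him_lo : T - y ≤ s.im := by rw [hsim]; linarith only [hsy.1]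
  have him_hi : s.im ≤ T + y := by rw [hsim]; linarith only [hsy.2]
  have hmaj := norm_riemannXi_le_strip_majorant' h0 h1 hδ hδ1 him12
  rw [xiSq_sq, show (1 / 2 : ℂ) + (((x : ℂ) + (T : ℂ) * I) + ((sgn * y : ℝ) : ℂ) * I) = s from rfl]
  have hlog : Real.log s.im ≤ Real.log (T + y) := Real.log_le_log (by linarith) him_hi
  have hvert := norm_xiGammaFactor_vertical_le_symm (σ := 1 + δ) (t := T) (t' := s.im) (t₀ := T - y)
    (by linarith) (by linarith) (by linarith) him_lo
  have hdt : |s.im - T| ≤ y := by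
    rw [hsim, show T + sgn * y - T = sgn * y by ring, abs_mul, hsg1, one_mul, abs_of_pos hy0]
  have hrate : (π / 4 + 6 / (T - y)) * |s.im - T| ≤ 4 / 5 * y := by
    have h6 : 6 / (T - y) ≤ 1 / 100 := by
      rw [div_le_iff₀ (by linarith)]; linarith
    have hr0' : 0 ≤ π / 4 + 6 / (T - y) := by
      have : 0 ≤ 6 / (T - y) := div_nonneg (by norm_num) (by linarith)
      linarith only [this, Real.pi_pos]
    calc (π / 4 + 6 / (T - y)) * |s.im - T| ≤ (π / 4 + 6 / (T - y)) * y :=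
          mul_le_mul_of_nonneg_left hdt hr0'
      _ ≤ 4 / 5 * y := by
          apply mul_le_mul_of_nonneg_right _ hy0.le
          linarith only [Real.pi_lt_d2, h6]
  have hG : ‖xiGammaFactor (((1 + δ : ℝ) : ℂ) + (s.im : ℂ) * I)‖ ≤
      ‖xiGammaFactor (((1 + δ : ℝ) : ℂ) + (T : ℂ) * I)‖ * Real.exp (4 / 5 * y) :=
    hvert.trans (mul_le_mul_of_nonneg_left (Real.exp_le_exp.2 hrate) (norm_nonneg _))
  have hξ : ‖riemannXi s‖ ≤ 672 * Real.log (T + y) * Real.exp (4 / 5 * y) *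
      ‖xiGammaFactor (((1 + δ : ℝ) : ℂ) + (T : ℂ) * I)‖ := by
    calc ‖riemannXi s‖ ≤ 672 * Real.log s.im * ‖xiGammaFactor (((1 + δ : ℝ) : ℂ) + (s.im : ℂ) * I)‖ := hmaj
      _ ≤ 672 * Real.log (T + y) *
          (‖xiGammaFactor (((1 + δ : ℝ) : ℂ) + (T : ℂ) * I)‖ * Real.exp (4 / 5 * y)) :=
          mul_le_mul (by linarith only [hlog]) hG (norm_nonneg _)
            (mul_nonneg (by norm_num) (Real.log_nonneg (by linarith)))
      _ = _ := by ring
  -- the peak: `‖I_r(φ₀)‖/r = ‖γ̃(½+u*)‖·‖K(u*)‖`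
  rw [norm_arcModelIntegrand_eq, circleMap_norm_arg, abs_of_nonneg (norm_nonneg _),
    mul_div_cancel_left₀ _ hr0.ne']
  have hyh2 : y ≤ 34 / 25 * bandRadius n T := by linarith
  generalize hh' : bandRadius n T = h at *
  generalize hXi : ‖riemannXi s‖ = Xi at *
  generalize hKw : ‖sqKernel n ((x : ℂ) + (T : ℂ) * I) (((x : ℂ) + (T : ℂ) * I) + ((sgn * y : ℝ) : ℂ) * I)‖ = Kw at *
  generalize hG1 : ‖xiGammaFactor (((1 + δ : ℝ) : ℂ) + (T : ℂ) * I)‖ = G1 at *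
  generalize hGs : ‖xiGammaFactor (1 / 2 + u)‖ = Gs at *
  generalize hKu : ‖sqKernel n ((x : ℂ) + (T : ℂ) * I) u‖ = Ku at *
  generalize hE1 : Real.exp (-(((1 / 2 + u).re - (1 + δ)) * (ell T / 2 - 1))) = E1 at *
  generalize hL : Real.log (T + y) = L at *
  have hXi0 : 0 ≤ Xi := by rw [← hXi]; exact norm_nonneg _
  have hKw0 : 0 ≤ Kw := by rw [← hKw]; exact norm_nonneg _
  have hG10 : 0 ≤ G1 := by rw [← hG1]; exact norm_nonneg _
  have hGs0 : 0 ≤ Gs := by rw [← hGs]; exact norm_nonneg _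
  have hKu0 : 0 ≤ Ku := by rw [← hKu]; exact norm_nonneg _
  have hE10 : 0 ≤ E1 := by rw [← hE1]; exact (Real.exp_pos _).le
  have hL0 : 0 ≤ L := by rw [← hL]; exact Real.log_nonneg (by linarith)
  have step1 : Xi * Kw ≤ (672 * L * Real.exp (4 / 5 * y) * G1) * (Real.exp (6 * h + 12) * Ku) :=
    mul_le_mul hξ hK hKw0 (by positivity)
  have step2 : (672 * L * Real.exp (4 / 5 * y) * G1) * (Real.exp (6 * h + 12) * Ku) ≤
      (672 * L * Real.exp (4 / 5 * y) * (Real.exp (h / 3) * E1 * Gs)) * (Real.exp (6 * h + 12) * Ku) := by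
    apply mul_le_mul_of_nonneg_right _ (by positivity)
    exact mul_le_mul_of_nonneg_left hγ (by positivity)
  have step3 : (672 * L * Real.exp (4 / 5 * y) * (Real.exp (h / 3) * E1 * Gs)) * (Real.exp (6 * h + 12) * Ku) =
      672 * L * (Real.exp (4 / 5 * y) * Real.exp (h / 3) * Real.exp (6 * h + 12)) * E1 * (Gs * Ku) := by ring
  have step4 : Real.exp (4 / 5 * y) * Real.exp (h / 3) * Real.exp (6 * h + 12) ≤ Real.exp (8 * h + 12) := by
    rw [← Real.exp_add, ← Real.exp_add]
    exact Real.exp_le_exp.2 (by linarith only [hyh2, hh, hy0])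
  calc Xi * Kw ≤ _ := step1
    _ ≤ _ := step2
    _ = _ := step3
    _ ≤ 672 * L * Real.exp (8 * h + 12) * E1 * (Gs * Ku) := by
        apply mul_le_mul_of_nonneg_right _ (by positivity)
        apply mul_le_mul_of_nonneg_right _ hE10
        exact mul_le_mul_of_nonneg_left step4 (by positivity)

end Summit.RiemannHypothesis.RiemannHypothesis.Theorems.JensenPolynomials.LogBandArc

end
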